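import Summits.KontsevichZagierPeriods.KontsevichZagierPeriods.Theorems.LinRedNormalFormArrangementNormalFormSeparateAllHHChart
import Summits.KontsevichZagierPeriods.KontsevichZagierPeriods.Theorems.LinRedNormalFormArrangementNormalFormSeparateAllHHForms

/-!
# The walls along a nested thin sector of any depth: sign, closure points, factorisation

(Line `janus-bands`, crux `ArrangementNormalForm`, stub `stub_separateHigh_hH`, part `AllHHSector` of
the dimension-generic wall-invariant termwise-split lemma, base dimension `b + 1 ≥ 4` with fibres;
namespace `SepAll`.)
Preparations of the sector theorem at a base point `z₁` of the closure of the (effective) base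
polyhedron `Y = {∀ j, 0 < rav x (φ j)} ⊆ ℝ^{b+1}` with frame `f` (parts `AllHHChart`, `AllHHForms`):
* NESTED VALUES: the effective forms, the letters `lval j` and the pole coordinate `lam` take
  nested affine values `SepAll.nlin` along the sector (`rav_npt`, `lval_npt`, `lam_npt`), so by
  the sign lemma of part `AllHHNest` every small sector lies inside `Y` or misses it (`in_or_out`);
* CLOSURE POINTS: if the small sectors lie inside `Y`, the truncated sector points (blown-up
  coordinates beyond a level switched off) lie in `closure Y` (`npt_trunc_mem_closure`); with the
  wall invariant `hH'` this forces every active letter through a pole point `z₁` to appear at a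
  level not exceeding the POLE LEVEL `j⋆` (first level `l` with `lamL (f l) ≠ 0`;
  `letter_level_le`) — the freeness of the deeper blown-up variables;
* FACTORISATION: every wall factor is a blown-up monomial times a regular factor
  (`factor_pow`, from `SepAll.nest_factor`), hence so is the common denominator
  `common = (∏ lval j ^ e j) · lam ^ n` along the sector: `common (z₁ + npt f w) = w^{Dv} · ω w` with
  `ω` continuous, `ω 0 ≠ 0`, and `Dv l ≠ 0` only at a pole point and only for `l ≤ j⋆`
  (`common_factor`, registered as `separateAllHH_sector`).
-/

noncomputable section

open Set Finset MeasureTheory Filter Topology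
open scoped ENNReal

namespace Summit.KontsevichZagierPeriods.ArrangementNormalForm.JanusBands

namespace SepAll

variable {b mL m'' : ℕ}

/-! ### The literal walls -/

/-- A real affine form of the effective base. -/
def rav (x : Fin (b + 1) → ℝ) (φj : (Fin (b + 1) → ℝ) × ℝ) : ℝ := (∑ i, φj.1 i * x i) + φj.2

/-- Its linear part. -/
def flin (φj : (Fin (b + 1) → ℝ) × ℝ) (v : Fin (b + 1) → ℝ) : ℝ := ∑ i, φj.1 i * v i

/-- A letter: an affine form in `x′`. -/
def lval (κ : Fin mL → Fin b → ℝ) (μ : Fin mL → ℝ) (j : Fin mL) (x : Fin (b + 1) → ℝ) : ℝ :=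
  ∑ i, κ j i * x (Fin.castSucc i) + μ j

/-- Its linear part. -/
def klin (κ : Fin mL → Fin b → ℝ) (j : Fin mL) (v : Fin (b + 1) → ℝ) : ℝ :=
  ∑ i, κ j i * v (Fin.castSucc i)

/-- The common denominator of the Taylor pieces. -/
def common (κ : Fin mL → Fin b → ℝ) (μ : Fin mL → ℝ) (e : Fin mL → ℕ) (n : ℕ) (l : Fin b → ℝ)
    (l₀ : ℝ) (x : Fin (b + 1) → ℝ) : ℝ :=
  (∏ j, lval κ μ j x ^ e j) * lam l l₀ x ^ n

/-- The sector point is the frame point of the nested products. -/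
theorem fpt_cum (z₁ : Fin (b + 1) → ℝ) (f : Fin (b + 1) → Fin (b + 1) → ℝ) (w : Fin (b + 1) → ℝ) :
    fpt z₁ f (fun l' => cum w l') = z₁ + npt f w := rfl

/-- A general affine form along the sector. -/
theorem affine_npt (c : Fin (b + 1) → ℝ) (c₀ : ℝ) (z₁ : Fin (b + 1) → ℝ)
    (f : Fin (b + 1) → Fin (b + 1) → ℝ) (w : Fin (b + 1) → ℝ) :
    (∑ i, c i * (z₁ + npt f w) i) + c₀ = nlin ((∑ i, c i * z₁ i) + c₀) (fun l' => ∑ i, c i * f l' i) w := by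
  simp only [nlin, Pi.add_apply, npt_apply, mul_add, Finset.sum_add_distrib, Finset.mul_sum]
  rw [Finset.sum_comm]
  have : ∀ l' i, c i * (cum w l' * f l' i) = cum w l' * (c i * f l' i) := fun _ _ => by ring
  simp_rw [this]
  ring

/-- **The effective forms along the sector.** -/
theorem rav_npt (φj : (Fin (b + 1) → ℝ) × ℝ) (z₁ : Fin (b + 1) → ℝ) (f : Fin (b + 1) → Fin (b + 1) → ℝ)
    (w : Fin (b + 1) → ℝ) : rav (z₁ + npt f w) φj = nlin (rav z₁ φj) (fun l' => flin φj (f l')) w :=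
  affine_npt φj.1 φj.2 z₁ f w

/-- **The letters along the sector.** -/
theorem lval_npt (κ : Fin mL → Fin b → ℝ) (μ : Fin mL → ℝ) (j : Fin mL) (z₁ : Fin (b + 1) → ℝ)
    (f : Fin (b + 1) → Fin (b + 1) → ℝ) (w : Fin (b + 1) → ℝ) :
    lval κ μ j (z₁ + npt f w) = nlin (lval κ μ j z₁) (fun l' => klin κ j (f l')) w := by
  unfold lval klin
  simp only [nlin, Pi.add_apply, npt_apply, mul_add, Finset.sum_add_distrib, Finset.mul_sum]
  rw [Finset.sum_comm]
  have : ∀ l' (i : Fin b), κ j i * (cum w l' * f l' (Fin.castSucc i)) =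
      cum w l' * (κ j i * f l' (Fin.castSucc i)) := fun _ _ => by ring
  simp_rw [this]
  ring

/-- **The pole coordinate along the sector.** -/
theorem lam_npt (l : Fin b → ℝ) (l₀ : ℝ) (z₁ : Fin (b + 1) → ℝ) (f : Fin (b + 1) → Fin (b + 1) → ℝ)
    (w : Fin (b + 1) → ℝ) : lam l l₀ (z₁ + npt f w) = nlin (lam l l₀ z₁) (fun l' => lamL l (f l')) w := by
  rw [← fpt_cum, lam_fpt]; rfl

/-- The effective base is measurable. -/
theorem measurableSet_Y (φ : Fin m'' → (Fin (b + 1) → ℝ) × ℝ) :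
    MeasurableSet {x : Fin (b + 1) → ℝ | ∀ j, 0 < rav x (φ j)} := by
  have hc : ∀ j, Continuous fun x : Fin (b + 1) → ℝ => rav x (φ j) := fun j => by
    unfold rav; fun_prop
  have : {x : Fin (b + 1) → ℝ | ∀ j, 0 < rav x (φ j)} = ⋂ j, (fun x => rav x (φ j)) ⁻¹' Ioi 0 := by
    ext x; simp
  rw [this]
  exact MeasurableSet.iInter fun j => (hc j).measurable measurableSet_Ioi

/-! ### Inside or outside -/

/-- **Every small nested sector lies inside the effective base or misses it.** -/
theorem in_or_out (φ : Fin m'' → (Fin (b + 1) → ℝ) × ℝ) (z₁ : Fin (b + 1) → ℝ)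
    (f : Fin (b + 1) → Fin (b + 1) → ℝ) : ∃ ρ₁ : ℝ, 0 < ρ₁ ∧
    ((∀ w : Fin (b + 1) → ℝ, (∀ j, 0 < w j ∧ w j ≤ ρ₁) → z₁ + npt f w ∈ {x | ∀ j, 0 < rav x (φ j)}) ∨
     (∀ w : Fin (b + 1) → ℝ, (∀ j, 0 < w j ∧ w j ≤ ρ₁) → z₁ + npt f w ∉ {x | ∀ j, 0 < rav x (φ j)})) := by
  obtain ⟨ρ₁, hρ₁, h⟩ := sign_nest_family (fun j => rav z₁ (φ j)) (fun j l' => flin (φ j) (f l'))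
  refine ⟨ρ₁, hρ₁, ?_⟩
  rcases h with h | ⟨j, hj⟩
  · refine Or.inl fun w hw => ?_
    show ∀ j, 0 < rav (z₁ + npt f w) (φ j)
    intro j
    rw [rav_npt]
    exact h w hw j
  · refine Or.inr fun w hw hmem => ?_
    have h1 : 0 < rav (z₁ + npt f w) (φ j) := hmem j
    rw [rav_npt] at h1
    exact absurd (hj w hw) (not_le.2 h1)

/-! ### Closure points -/

/-- Nested products of a truncated point vanish beyond the truncation level. -/
theorem cum_trunc_of_lt {ρ : ℝ} {jstar l' : Fin (b + 1)} (h : jstar < l') :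
    cum (fun j : Fin (b + 1) => if j ≤ jstar then ρ else 0) l' = 0 := by
  unfold cum
  refine Finset.prod_eq_zero (Finset.mem_univ l') ?_
  show (if l' ≤ l' then (if l' ≤ jstar then ρ else 0) else 1) = 0
  rw [if_pos le_rfl, if_neg (not_le.2 h)]

/-- Nested products of a truncated point are positive up to the truncation level. -/
theorem cum_trunc_pos {ρ : ℝ} (hρ : 0 < ρ) {jstar l' : Fin (b + 1)} (h : l' ≤ jstar) :
    0 < cum (fun j : Fin (b + 1) => if j ≤ jstar then ρ else 0) l' :=
  Finset.prod_pos fun j _ => by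
    show 0 < (if j ≤ l' then (if j ≤ jstar then ρ else 0) else 1)
    by_cases hj : j ≤ l'
    · rw [if_pos hj, if_pos (hj.trans h)]; exact hρ
    · rw [if_neg hj]; exact one_pos

/-- **Truncated sector points lie in the closure of the base** when the small sectors lie inside. -/
theorem npt_trunc_mem_closure (Y : Set (Fin (b + 1) → ℝ)) (z₁ : Fin (b + 1) → ℝ)
    (f : Fin (b + 1) → Fin (b + 1) → ℝ) {ρ₁ : ℝ} (hρ₁ : 0 < ρ₁)
    (hin : ∀ w : Fin (b + 1) → ℝ, (∀ j, 0 < w j ∧ w j ≤ ρ₁) → z₁ + npt f w ∈ Y) (jstar : Fin (b + 1)) :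
    z₁ + npt f (fun j => if j ≤ jstar then ρ₁ else 0) ∈ closure Y := by
  set wη : ℝ → Fin (b + 1) → ℝ := fun η j => if j ≤ jstar then ρ₁ else η with hwη
  have hc : Continuous fun η => z₁ + npt f (wη η) := by
    refine continuous_const.add ((continuous_npt f).comp (continuous_pi fun j => ?_))
    by_cases h : j ≤ jstar
    · simp only [hwη, h, if_true]; exact continuous_const
    · simp only [hwη, h, if_false]; exact continuous_id
  have ht : Tendsto (fun η => z₁ + npt f (wη η)) (𝓝[>] 0) (𝓝 (z₁ + npt f (wη 0))) :=
    (hc.tendsto 0).mono_left nhdsWithin_le_nhds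
  refine mem_closure_of_tendsto ht ?_
  filter_upwards [Ioo_mem_nhdsGT hρ₁] with η hη
  refine hin _ fun j => ?_
  by_cases h : j ≤ jstar
  · simp only [hwη, h, if_true]; exact ⟨hρ₁, le_rfl⟩
  · simp only [hwη, h, if_false]; exact ⟨hη.1, hη.2.le⟩

/-- **Active letters through a pole point appear no later than the pole level** (the wall
invariant at the closure points). -/
theorem letter_level_le {Y : Set (Fin (b + 1) → ℝ)} (κ : Fin mL → Fin b → ℝ) (μ : Fin mL → ℝ)
    (e : Fin mL → ℕ) (n : ℕ) (l : Fin b → ℝ) (l₀ : ℝ)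
    (hH' : ∀ j, e j ≠ 0 → ∀ x ∈ closure Y, lval κ μ j x = 0 → n ≠ 0 ∧ lam l l₀ x = 0)
    (z₁ : Fin (b + 1) → ℝ) (f : Fin (b + 1) → Fin (b + 1) → ℝ) {ρ₁ : ℝ} (hρ₁ : 0 < ρ₁)
    (hin : ∀ w : Fin (b + 1) → ℝ, (∀ j, 0 < w j ∧ w j ≤ ρ₁) → z₁ + npt f w ∈ Y)
    (hlamz : lam l l₀ z₁ = 0) (jstar : Fin (b + 1)) (hlow : ∀ l', l' < jstar → lamL l (f l') = 0)
    (hjs : lamL l (f jstar) ≠ 0) (j : Fin mL) (hej : e j ≠ 0) (hLz : lval κ μ j z₁ = 0) :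
    ∃ l', l' ≤ jstar ∧ klin κ j (f l') ≠ 0 := by
  by_contra hall
  push Not at hall
  set w₀ : Fin (b + 1) → ℝ := fun j' => if j' ≤ jstar then ρ₁ else 0 with hw₀
  have hmem := npt_trunc_mem_closure Y z₁ f hρ₁ hin jstar
  have hL : lval κ μ j (z₁ + npt f w₀) = 0 := by
    rw [lval_npt, nlin, hLz, zero_add]
    refine Finset.sum_eq_zero fun l' _ => ?_
    by_cases h : l' ≤ jstar
    · rw [hall l' h, mul_zero]
    · rw [hw₀, cum_trunc_of_lt (not_le.1 h), zero_mul]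
  have hlam : lam l l₀ (z₁ + npt f w₀) = cum w₀ jstar * lamL l (f jstar) := by
    rw [lam_npt, nlin, hlamz, zero_add, ← Finset.sum_erase_add _ _ (Finset.mem_univ jstar)]
    rw [Finset.sum_eq_zero fun l' hl' => ?_, zero_add]
    rcases lt_or_gt_of_ne (Finset.ne_of_mem_erase hl') with h | h
    · rw [hlow l' h, mul_zero]
    · rw [hw₀, cum_trunc_of_lt h, zero_mul]
  have h2 := (hH' j hej _ hmem hL).2
  rw [hlam] at h2
  exact (mul_ne_zero (cum_trunc_pos hρ₁ le_rfl).ne' hjs) h2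

/-! ### Factorisation of the walls -/

/-- Sums of exponents give products of monomials. -/
theorem mono_add (Dv Dv' : Fin (b + 1) → ℕ) (w : Fin (b + 1) → ℝ) :
    mono (Dv + Dv') w = mono Dv w * mono Dv' w := by
  unfold mono
  rw [← Finset.prod_mul_distrib]
  exact Finset.prod_congr rfl fun l' _ => by rw [Pi.add_apply, pow_add]

/-- Powers of nested products are monomials. -/
theorem cum_pow_eq_mono (w : Fin (b + 1) → ℝ) (r : Fin (b + 1)) (e' : ℕ) :
    cum w r ^ e' = mono (fun l' => if l' ≤ r then e' else 0) w := by
  unfold cum mono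
  rw [← Finset.prod_pow]
  refine Finset.prod_congr rfl fun l' _ => ?_
  show (if l' ≤ r then w l' else 1) ^ e' = w l' ^ (if l' ≤ r then e' else 0)
  by_cases h : l' ≤ r
  · rw [if_pos h, if_pos h]
  · rw [if_neg h, if_neg h, one_pow, pow_zero]

/-- Nested affine values at the corner. -/
theorem nlin_zero (c₀ : ℝ) (α : Fin (b + 1) → ℝ) : nlin c₀ α 0 = c₀ := by
  unfold nlin
  rw [add_eq_left]
  refine Finset.sum_eq_zero fun l' _ => ?_
  have : cum (0 : Fin (b + 1) → ℝ) l' = 0 :=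
    Finset.prod_eq_zero (Finset.mem_univ l') (by simp)
  rw [this, zero_mul]

/-- **Every wall factor is a blown-up monomial times a regular factor.** The exponents are
supported on levels below which the linear part vanishes. -/
theorem factor_pow (c₀ : ℝ) (α : Fin (b + 1) → ℝ) (e' : ℕ) (hnd : c₀ = 0 → e' ≠ 0 → ∃ l', α l' ≠ 0) :
    ∃ (Dv : Fin (b + 1) → ℕ) (ω : (Fin (b + 1) → ℝ) → ℝ), Continuous ω ∧ ω 0 ≠ 0 ∧
      (∀ w, nlin c₀ α w ^ e' = mono Dv w * ω w) ∧
      (∀ l', Dv l' ≠ 0 → c₀ = 0 ∧ e' ≠ 0 ∧ ∀ l'', l'' < l' → α l'' = 0) := by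
  classical
  have hcont : Continuous (nlin c₀ α) := by
    unfold nlin
    exact continuous_const.add (continuous_finsetSum _ fun l' _ => (continuous_cum l').mul continuous_const)
  by_cases hc : c₀ ≠ 0
  · refine ⟨0, fun w => nlin c₀ α w ^ e', hcont.pow _, ?_, fun w => by simp [mono], fun l' h => absurd rfl h⟩
    show nlin c₀ α 0 ^ e' ≠ 0
    rw [nlin_zero]; exact pow_ne_zero _ hc
  push Not at hc
  by_cases he : e' = 0
  · refine ⟨0, fun _ => 1, continuous_const, one_ne_zero, fun w => by simp [mono, he], fun l' h => absurd rfl h⟩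
  obtain ⟨l₁, hl₁⟩ := hnd hc he
  set S : Finset (Fin (b + 1)) := univ.filter fun l' => α l' ≠ 0 with hS
  have hSne : S.Nonempty := ⟨l₁, Finset.mem_filter.2 ⟨Finset.mem_univ _, hl₁⟩⟩
  set r := S.min' hSne with hr
  have hαr : α r ≠ 0 := (Finset.mem_filter.1 (Finset.min'_mem S hSne)).2
  have hlow : ∀ l', l' < r → α l' = 0 := by
    intro l' hl'
    by_contra hne
    exact absurd (Finset.min'_le S l' (Finset.mem_filter.2 ⟨Finset.mem_univ _, hne⟩)) (not_le.2 (hr ▸ hl'))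
  refine ⟨fun l' => if l' ≤ r then e' else 0, fun w => unitOf α r w ^ e', (continuous_unitOf α r).pow _,
    ?_, fun w => ?_, fun l' h => ⟨hc, he, fun l'' hl'' => ?_⟩⟩
  · show unitOf α r 0 ^ e' ≠ 0
    rw [unitOf_zero]; exact pow_ne_zero _ hαr
  · rw [nlin, hc, zero_add, nest_factor hlow, mul_pow, cum_pow_eq_mono]
  · have : l' ≤ r := by by_contra h'; exact h (if_neg h')
    exact hlow l'' (lt_of_lt_of_le hl'' this)

/-- Products of factored functions are factored. -/
theorem factor_prod {ι : Type*} (s : Finset ι) (F : ι → (Fin (b + 1) → ℝ) → ℝ) (P : ι → Fin (b + 1) → Prop)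
    (h : ∀ i ∈ s, ∃ (Dv : Fin (b + 1) → ℕ) (ω : (Fin (b + 1) → ℝ) → ℝ), Continuous ω ∧ ω 0 ≠ 0 ∧
      (∀ w, F i w = mono Dv w * ω w) ∧ ∀ l', Dv l' ≠ 0 → P i l') :
    ∃ (Dv : Fin (b + 1) → ℕ) (ω : (Fin (b + 1) → ℝ) → ℝ), Continuous ω ∧ ω 0 ≠ 0 ∧
      (∀ w, ∏ i ∈ s, F i w = mono Dv w * ω w) ∧ ∀ l', Dv l' ≠ 0 → ∃ i ∈ s, P i l' := by
  classical
  induction s using Finset.induction_on with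
  | empty =>
    exact ⟨0, fun _ => 1, continuous_const, one_ne_zero, fun w => by simp [mono], fun l' h => absurd rfl h⟩
  | insert i s hi ih =>
    obtain ⟨Dv₁, ω₁, hc₁, h0₁, hF₁, hP₁⟩ := h i (Finset.mem_insert_self i s)
    obtain ⟨Dv₂, ω₂, hc₂, h0₂, hF₂, hP₂⟩ := ih fun i' hi' => h i' (Finset.mem_insert_of_mem hi')
    refine ⟨Dv₁ + Dv₂, fun w => ω₁ w * ω₂ w, hc₁.mul hc₂, mul_ne_zero h0₁ h0₂, fun w => ?_, fun l' hl' => ?_⟩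
    · rw [Finset.prod_insert hi, hF₁, hF₂, mono_add]; ring
    · have : Dv₁ l' ≠ 0 ∨ Dv₂ l' ≠ 0 := by
        by_contra hh; push Not at hh; exact hl' (by rw [Pi.add_apply, hh.1, hh.2])
      rcases this with h1 | h2
      · exact ⟨i, Finset.mem_insert_self i s, hP₁ l' h1⟩
      · obtain ⟨i', hi', hP⟩ := hP₂ l' h2
        exact ⟨i', Finset.mem_insert_of_mem hi', hP⟩

/-- A non-zero linear functional does not vanish on a basis. -/
theorem exists_ne_zero_of_basis {f : Fin (b + 1) → Fin (b + 1) → ℝ} (hf : LinearIndependent ℝ f)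
    (c : Fin (b + 1) → ℝ) (hc : c ≠ 0) : ∃ l', (∑ i, c i * f l' i) ≠ 0 := by
  by_contra hall
  push Not at hall
  -- the functional `v ↦ ∑ c i v i` kills the span of the frame, which is everything
  have hspan : ⊤ ≤ Submodule.span ℝ (Set.range f) :=
    (hf.span_eq_top_of_card_eq_finrank' (by simp)).ge
  set L : (Fin (b + 1) → ℝ) →ₗ[ℝ] ℝ := (LinearMap.lsum ℝ (fun _ => ℝ) ℝ fun i => LinearMap.lsmul ℝ ℝ (c i))
    with hL
  have hLapply : ∀ v, L v = ∑ i, c i * v i := fun v => by simp [hL, LinearMap.lsum_apply]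
  have hker : Submodule.span ℝ (Set.range f) ≤ LinearMap.ker L := by
    refine Submodule.span_le.2 ?_
    rintro _ ⟨l', rfl⟩
    simp only [SetLike.mem_coe, LinearMap.mem_ker, hLapply]
    exact hall l'
  obtain ⟨i, hi⟩ := Function.ne_iff.1 hc
  have hmem : (Pi.single i 1 : Fin (b + 1) → ℝ) ∈ LinearMap.ker L := hker (hspan Submodule.mem_top)
  rw [LinearMap.mem_ker, hLapply] at hmem
  simp only [Pi.single_apply, mul_ite, mul_one, mul_zero, Finset.sum_ite_eq', Finset.mem_univ,
    if_true] at hmem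
  exact hi hmem

/-- **The pole level**: the first level at which the pole coordinate has a non-zero slope. -/
theorem exists_pole_level (l : Fin b → ℝ) {f : Fin (b + 1) → Fin (b + 1) → ℝ} (hf : LinearIndependent ℝ f) :
    ∃ jstar : Fin (b + 1), (∀ l', l' < jstar → lamL l (f l') = 0) ∧ lamL l (f jstar) ≠ 0 := by
  classical
  -- `lamL` is the functional with coefficients `(-l, 1)`
  set c : Fin (b + 1) → ℝ := Fin.snoc (fun i => -l i) 1 with hc
  have hceval : ∀ v : Fin (b + 1) → ℝ, (∑ i, c i * v i) = lamL l v := by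
    intro v
    rw [Fin.sum_univ_castSucc, lamL]
    simp [hc, Fin.snoc_castSucc, Fin.snoc_last]
    ring
  have hc0 : c ≠ 0 := fun h => by
    have := congrFun h (Fin.last b)
    simp [hc] at this
  obtain ⟨l₁, hl₁⟩ := exists_ne_zero_of_basis hf c hc0
  rw [hceval] at hl₁
  set S : Finset (Fin (b + 1)) := univ.filter fun l' => lamL l (f l') ≠ 0 with hS
  have hSne : S.Nonempty := ⟨l₁, Finset.mem_filter.2 ⟨Finset.mem_univ _, hl₁⟩⟩
  refine ⟨S.min' hSne, fun l' hl' => ?_, (Finset.mem_filter.1 (Finset.min'_mem S hSne)).2⟩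
  by_contra hne
  exact absurd (Finset.min'_le S l' (Finset.mem_filter.2 ⟨Finset.mem_univ _, hne⟩)) (not_le.2 hl')

/-- **Factorisation of the common denominator along a nested sector.** See the module docstring. -/
theorem common_factor {Y : Set (Fin (b + 1) → ℝ)} (κ : Fin mL → Fin b → ℝ) (μ : Fin mL → ℝ)
    (e : Fin mL → ℕ) (n : ℕ) (l : Fin b → ℝ) (l₀ : ℝ)
    (hκ0 : ∀ j, e j ≠ 0 → κ j = 0 → μ j ≠ 0)
    (hH' : ∀ j, e j ≠ 0 → ∀ x ∈ closure Y, lval κ μ j x = 0 → n ≠ 0 ∧ lam l l₀ x = 0)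
    (z₁ : Fin (b + 1) → ℝ) (hz₁ : z₁ ∈ closure Y) (f : Fin (b + 1) → Fin (b + 1) → ℝ)
    (hf : LinearIndependent ℝ f) {ρ₁ : ℝ} (hρ₁ : 0 < ρ₁)
    (hin : ∀ w : Fin (b + 1) → ℝ, (∀ j, 0 < w j ∧ w j ≤ ρ₁) → z₁ + npt f w ∈ Y)
    (jstar : Fin (b + 1)) (hlow : ∀ l', l' < jstar → lamL l (f l') = 0) (hjs : lamL l (f jstar) ≠ 0) :
    ∃ (Dv : Fin (b + 1) → ℕ) (ω : (Fin (b + 1) → ℝ) → ℝ), Continuous ω ∧ ω 0 ≠ 0 ∧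
      (∀ w, common κ μ e n l l₀ (z₁ + npt f w) = mono Dv w * ω w) ∧
      (∀ l', Dv l' ≠ 0 → (n ≠ 0 ∧ lam l l₀ z₁ = 0) ∧ l' ≤ jstar) := by
  -- the letters
  have hlet : ∀ j ∈ (univ : Finset (Fin mL)), ∃ (Dv : Fin (b + 1) → ℕ) (ω : (Fin (b + 1) → ℝ) → ℝ),
      Continuous ω ∧ ω 0 ≠ 0 ∧ (∀ w, lval κ μ j (z₁ + npt f w) ^ e j = mono Dv w * ω w) ∧
      ∀ l', Dv l' ≠ 0 → (n ≠ 0 ∧ lam l l₀ z₁ = 0) ∧ l' ≤ jstar := by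
    intro j _
    obtain ⟨Dv, ω, hc, h0, hF, hP⟩ := factor_pow (lval κ μ j z₁) (fun l' => klin κ j (f l')) (e j)
      (fun hLz hej => by
        have hκ : κ j ≠ 0 := fun hk => by
          have : lval κ μ j z₁ = μ j := by simp [lval, hk]
          exact hκ0 j hej hk (this ▸ hLz)
        have hsnoc : (Fin.snoc (κ j) 0 : Fin (b + 1) → ℝ) ≠ 0 := fun h => hκ (by
          funext i
          have := congrFun h (Fin.castSucc i)
          simpa [Fin.snoc_castSucc] using this)
        obtain ⟨l', hl'⟩ := exists_ne_zero_of_basis hf (Fin.snoc (κ j) 0) hsnoc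
        refine ⟨l', ?_⟩
        rw [Fin.sum_univ_castSucc] at hl'
        simpa [klin, Fin.snoc_castSucc, Fin.snoc_last] using hl')
    refine ⟨Dv, ω, hc, h0, fun w => by rw [lval_npt]; exact hF w, fun l' hl' => ?_⟩
    obtain ⟨hLz, hej, hbelow⟩ := hP l' hl'
    have hpole := hH' j hej z₁ hz₁ hLz
    obtain ⟨l'', hl''js, hl''⟩ := letter_level_le κ μ e n l l₀ hH' z₁ f hρ₁ hin hpole.2 jstar hlow hjs j hej hLz
    refine ⟨hpole, le_trans (not_lt.1 fun h => hl'' (hbelow l'' h)) hl''js⟩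
  obtain ⟨Dv₁, ω₁, hc₁, h0₁, hF₁, hP₁⟩ := factor_prod univ (fun j w => lval κ μ j (z₁ + npt f w) ^ e j)
    (fun _ l' => (n ≠ 0 ∧ lam l l₀ z₁ = 0) ∧ l' ≤ jstar) hlet
  -- the pole
  obtain ⟨Dv₂, ω₂, hc₂, h0₂, hF₂, hP₂⟩ := factor_pow (lam l l₀ z₁) (fun l' => lamL l (f l')) n
    (fun _ _ => ⟨jstar, hjs⟩)
  refine ⟨Dv₁ + Dv₂, fun w => ω₁ w * ω₂ w, hc₁.mul hc₂, mul_ne_zero h0₁ h0₂, fun w => ?_, fun l' hl' => ?_⟩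
  · rw [common, hF₁, lam_npt, hF₂, mono_add]; ring
  · have : Dv₁ l' ≠ 0 ∨ Dv₂ l' ≠ 0 := by
      by_contra hh; push Not at hh; exact hl' (by rw [Pi.add_apply, hh.1, hh.2])
    rcases this with h1 | h2
    · obtain ⟨_, -, hP⟩ := hP₁ l' h1
      exact hP
    · obtain ⟨hlamz, hn, hbelow⟩ := hP₂ l' h2
      exact ⟨⟨hn, hlamz⟩, not_lt.1 fun h => hjs (hbelow jstar h)⟩

end SepAll

/-- **Factorisation of the common denominator along a nested thin sector of any depth**
(registered part of `stub_separateHigh_hH`; literal form of `SepAll.common_factor`): at a point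
`z₁` of the closure of the base whose small nested sectors with the independent frame `f` lie
inside, under the wall invariant, the common denominator is a blown-up monomial `∏ w_l^{Dv l}`
times a continuous factor non-vanishing at the corner, and `Dv l ≠ 0` only at a pole point and only
up to the pole level. -/
theorem separateAllHH_sector (b mL : ℕ) (Y : Set (Fin (b + 1) → ℝ)) (κ : Fin mL → Fin b → ℝ) (μ : Fin mL → ℝ) (e : Fin mL → ℕ) (n : ℕ) (l : Fin b → ℝ) (l₀ : ℝ) (hκ0 : ∀ j, e j ≠ 0 → κ j = 0 → μ j ≠ 0) (hH' : ∀ j, e j ≠ 0 → ∀ x ∈ closure Y, SepAll.lval κ μ j x = 0 → n ≠ 0 ∧ SepAll.lam l l₀ x = 0) (z₁ : Fin (b + 1) → ℝ) (hz₁ : z₁ ∈ closure Y) (f : Fin (b + 1) → Fin (b + 1) → ℝ) (hf : LinearIndependent ℝ f) (ρ₁ : ℝ) (hρ₁ : 0 < ρ₁) (hin : ∀ w : Fin (b + 1) → ℝ, (∀ j, 0 < w j ∧ w j ≤ ρ₁) → z₁ + SepAll.npt f w ∈ Y) (jstar : Fin (b + 1)) (hlow : ∀ l', l' < jstar → SepAll.lamL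 l (f l') = 0) (hjs : SepAll.lamL l (f jstar) ≠ 0) : ∃ (Dv : Fin (b + 1) → ℕ) (ω : (Fin (b + 1) → ℝ) → ℝ), Continuous ω ∧ ω 0 ≠ 0 ∧ (∀ w, SepAll.common κ μ e n l l₀ (z₁ + SepAll.npt f w) = SepAll.mono Dv w * ω w) ∧ (∀ l', Dv l' ≠ 0 → (n ≠ 0 ∧ SepAll.lam l l₀ z₁ = 0) ∧ l' ≤ jstar) := by
  exact SepAll.common_factor κ μ e n l l₀ hκ0 hH' z₁ hz₁ f hf hρ₁ hin jstar hlow hjs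

end Summit.KontsevichZagierPeriods.ArrangementNormalForm.JanusBands
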